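import Summits.FinalStateConjecture.FinalStateConjecture.Theorems.ZeroEnergyKerrOrBombHawkingExtensionIsKerrSECAtlas
import HarnessLib

/-!
# Crux `HawkingExtensionIsKerr` (stmt-FinalStateConjecture-17840), line `SketchIdeator2` —
# programme TOP, brick TOP-C (generalised SEC), part 1: invariance of domain on a `C⁰` surface

Worker file for the registered stub `stub_top_secGen` (lead c8).  Programme SEC (c7, brick SEC-4,
`…SECAtlas`) proved invariance of domain for continuous injections `W → ℝ²` from open subsets of a
space HOMEOMORPHIC TO `S²` (`isOpen_image_of_injOn_of_sphereLike`, through the stereographic charts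
of Mathlib's sphere).  Programme TOP only knows that the `C⁰` cross-section carries SOME `C⁰` atlas
modelled on `ℝ²`; this file generalises the lemma accordingly:

* `isOpen_image_of_injOn_of_chartedSpace` — for ANY `[ChartedSpace (EuclideanSpace ℝ (Fin 2)) C]`,
  `W ⊆ C` open and `f : C → ℝ²` continuous and injective on `W`, the image `f '' W` is open: around
  `c ∈ W`, with `φ = chartAt ℝ² c`, the map `g = f ∘ φ.symm` is continuous and injective on the open
  set `O = φ.target ∩ φ.symm ⁻¹' W ⊆ ℝ²`, so `g '' O` is open by the tree's Brouwer invariance of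
  domain (`Literature.Topology.Euclidean.Brouwer.isOpen_image_of_injOn`), contains `f c` and lies in
  `f '' W`;
* `sec_atlas_gen` — the conjunction replacing `stub_sec_atlas` in the generalised SEC pipeline:
  (i) the above for all open `V' ⊆ V`, (ii) c7's `exists_isManifold_of_finite_charts` verbatim.
-/

noncomputable section

set_option linter.dupNamespace false

namespace Summit.FinalStateConjecture.FinalStateConjecture.Theorems.HawkingExtensionIsKerr.SketchIdeator2

open Set Filter Bundle Function Literature.Geometry.Lorentzian
open scoped Manifold ContDiff Topology

/-- **Invariance of domain on a space with a `C⁰` atlas modelled on `ℝ²`.**  If `C` carries a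
`ChartedSpace (EuclideanSpace ℝ (Fin 2))` structure, `W ⊆ C` is open and `f : C → ℝ²` is continuous
and injective on `W`, then `f '' W` is open in `ℝ²`.  Around `c ∈ W`: with `φ = chartAt ℝ² c` the map
`g = f ∘ φ.symm` is continuous and injective on the open set `O = φ.target ∩ φ.symm ⁻¹' W`, hence
`g '' O` is open (Brouwer, `Literature.Topology.Euclidean.Brouwer.isOpen_image_of_injOn`), and
`f c ∈ g '' O ⊆ f '' W`.  (Adapted from c7's `isOpen_image_of_injOn_of_sphereLike`.) -/
theorem isOpen_image_of_injOn_of_chartedSpace {C : Type*} [TopologicalSpace C]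
    [ChartedSpace (EuclideanSpace ℝ (Fin 2)) C] {W : Set C} {f : C → EuclideanSpace ℝ (Fin 2)}
    (hW : IsOpen W) (hf : ContinuousOn f W) (hinj : InjOn f W) : IsOpen (f '' W) := by
  rw [isOpen_iff_forall_mem_open]
  rintro _ ⟨c, hc, rfl⟩
  set φ := chartAt (EuclideanSpace ℝ (Fin 2)) c with hφ
  set O : Set (EuclideanSpace ℝ (Fin 2)) := φ.target ∩ φ.symm ⁻¹' W with hO
  have hOopen : IsOpen O := φ.symm.isOpen_inter_preimage hW
  have hmaps : MapsTo (fun y => φ.symm y) O W := fun y hy => hy.2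
  have hgc : ContinuousOn (fun y => f (φ.symm y)) O :=
    hf.comp (φ.continuousOn_symm.mono inter_subset_left) hmaps
  have hginj : InjOn (fun y => f (φ.symm y)) O := by
    intro y hy y' hy' h
    have h1 : φ.symm y = φ.symm y' := hinj hy.2 hy'.2 h
    exact φ.symm.injOn hy.1 hy'.1 h1
  have hopen : IsOpen ((fun y => f (φ.symm y)) '' O) :=
    Literature.Topology.Euclidean.Brouwer.isOpen_image_of_injOn rfl hOopen hgc hginj
  refine ⟨(fun y => f (φ.symm y)) '' O, ?_, hopen, ?_⟩
  · rintro _ ⟨y, hy, rfl⟩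
    exact ⟨φ.symm y, hy.2, rfl⟩
  · have hsrc : c ∈ φ.source := mem_chart_source _ _
    refine ⟨φ c, ⟨φ.map_source hsrc, ?_⟩, ?_⟩
    · show φ.symm (φ c) ∈ W
      rw [φ.left_inv hsrc]
      exact hc
    · show f (φ.symm (φ c)) = f c
      rw [φ.left_inv hsrc]

/-- **TOP-C, generic topology (generalised SEC-4).**  (i) Invariance of domain on a space with a `C⁰`
atlas modelled on `ℝ²`: continuous injections from its open subsets to `ℝ²` are open
(`isOpen_image_of_injOn_of_chartedSpace`); (ii) c7's finite smooth atlases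
(`exists_isManifold_of_finite_charts`, verbatim second conjunct of `stub_sec_atlas`). -/
theorem sec_atlas_gen : (∀ (C : Type) [TopologicalSpace C] [ChartedSpace (EuclideanSpace ℝ (Fin 2)) C], ∀ (V : Set C) (f : C → EuclideanSpace ℝ (Fin 2)), IsOpen V → ContinuousOn f V → InjOn f V → ∀ V' ⊆ V, IsOpen V' → IsOpen (f '' V')) ∧
    (∀ (X : Type) [TopologicalSpace X] [T2Space X] (N : ℕ) (V : Fin N → Set X) (f : Fin N → X → EuclideanSpace ℝ (Fin 2)) (fi : Fin N → EuclideanSpace ℝ (Fin 2) → X), (∀ i, IsOpen (V i)) → (∀ x, ∃ i, x ∈ V i) → (∀ i, ContinuousOn (f i) (V i)) → (∀ i, ∀ V' ⊆ V i, IsOpen V' → IsOpen (f i '' V')) → (∀ i, ∀ x ∈ V i, fi i (f i x) = x) → (∀ i j, ContDiffOn ℝ ∞ (f j ∘ fi i) (f i '' (V i ∩ V j))) → ∃ (_ : ChartedSpace (EuclideanSpace ℝ (Fin 2)) X) (_ : IsManifold (𝓡 2) ∞ X), (∀ i, ContMDiffOn (𝓡 2) 𝓘(ℝ, EuclideanSpace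 ℝ (Fin 2)) ∞ (f i) (V i)) ∧ (∀ i, ContMDiffOn 𝓘(ℝ, EuclideanSpace ℝ (Fin 2)) (𝓡 2) ∞ (fi i) (f i '' V i))) := by
  refine ⟨?_, stub_sec_atlas.2⟩
  intro C _ _ V f _hV hf hinj V' hV'V hV'
  exact isOpen_image_of_injOn_of_chartedSpace hV' (hf.mono hV'V) (hinj.mono hV'V)

end Summit.FinalStateConjecture.FinalStateConjecture.Theorems.HawkingExtensionIsKerr.SketchIdeator2

end
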